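import Summits.ResolutionOfSingularities.ResolutionOfSingularities.Theorems.PurelyInseparableDim4ResConeLightPairRepresentation
import Summits.ResolutionOfSingularities.ResolutionOfSingularities.Theorems.PurelyInseparableDim4ResConeSatellitePair
import HarnessLib
import HarnessLib.Audit.Tags

/-!
# Purely inseparable four-folds — TT HOLDS ALONG THE (5,4) LIGHT-PAIR TAIL, hence THE LIGHT-PAIR TAIL IS EMPTY: hN4-C′ DISCHARGED
# (cell `res-dim4-pi`, K2(p) lane, slice C; hN4-C′ = light-pair `(5,4)` re-presentation, file 4)

[OURS · counted 0 · cell `res-dim4-pi` · K2(p) lane (LEDGER v8.2: hN4-C′ = res-dim4-p-3); the degenerate-kernel argument is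
res-dim4-p-1 g5's («the degenerate case dies by itself: … forces every later step to be non-satellite ⟹ FT», bus 2026-08-29
06:53:52Z) in the light-pair dress; TT vocabulary res-dim4-p-5 g4; seat res-dim4-p-3 g4.]  Nothing here proves K2(p)/K2(5),
`NoIsolatedTrap 5 5`, TAIL-D or resolution of singularities in dimension ≥ 4 / characteristic `p` — NOT proved.  AI kernel work,
weaker than expert review.

THE ARGUMENT.  Light-pair regime (shade `4`, `e_G = 2`, two weight-`1` letters).  If at time `m` the polar kernel `V_m` (a plane)
contains a non-zero `w` vanishing on both boundary letters (TT FAILS), then with the step direction `D_m ∈ V_m`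
(`direction_mem_resVertex_of_shade_eq`) and (I2) `V_{m+1} ⊓ H_{j m} = V_m ⊓ H_{j m}` (`resVertex_step_inf_hyperplane_eq_of_finrank_eq`),
the vector `v₀ = w − w_{j m}·D_m` is a non-zero element of `V_{m+1}` vanishing on the boundary letters of `c (m+1)` — TT fails at
`m + 1` — and `V_{m+1} ⊓ H_{j m} = K·v₀` (it is a line, `finrank_resVertex_step_inf_hyperplane_add_one_of_finrank_eq`), so the next
direction `D_{m+1}` (which charges a boundary letter) has `(D_{m+1})_{j m} ≠ 0`: step `m + 1` is NOT satellite.  By induction no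
satellite step after `m`, contradicting the free-tail theorem `exists_satellite_ge`.  Hence TT holds at every time of the tail,
and `no_light_pair_tail_four_five_of_TT` becomes unconditional.
* `lightPair_direction_slot` — every step direction of the tail charges a boundary letter.
* `lightPair_deg_step` — the degenerate kernel vector propagates one step, and pins the next direction off `H_{j m}`.
* `lightPair_not_satellite_of_deg` — hence the next step is not satellite.
* **`lightPair_TT`** — TT at every time `k ≥ k₀`.
* **`no_light_pair_tail_four_five`** — the `(5,4)` light-pair `e_G = 2` tail is EMPTY (no residual hypothesis).
* **`lightPair_representation`** — the hN4-C′ socket binder of `…ResConeRepresentationSockets` (`no_light_pair_tail_of_representation`),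
  character for character, is a THEOREM.

[cite: CossartJannsenSaito2020, Thm. 3.10(4), Thm. 3.14] [cite: Hauser2010, §§F–G]
bears_on: LADDER-RESOLUTION:D157-DOOR2 (res-dim4-pi · K2(p) slice C · hN4-C′ DISCHARGED).
Supports stmt-ResolutionOfSingularities-16155 (helper).
-/

set_option linter.dupNamespace false -- mandated namespace of this single-conjunct summit

noncomputable section

namespace Summit.ResolutionOfSingularities.ResolutionOfSingularities.Theorems.PIDim4

namespace ResCone

open MvPolynomial Finset
open Literature.AlgebraicGeometry.Resolution
open Literature.AlgebraicGeometry.Resolution.CentreBlowup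
open Literature.AlgebraicGeometry.Resolution.Hauser2010
open Literature.AlgebraicGeometry.Resolution.HauserPerlega2019
open PointBlowup (direction)

variable {K : Type} [Field K] [CharP K 5] [DecidableEq K]

section Tail

omit [CharP K 5] in
/-- Order `6` along the light-pair tail. [folklore] -/
theorem lightPair_ordZero_six {c : ℕ → State K} (hc : ∀ k, IsIsolated 5 (c k).F ∧ Step0 5 (c k) (c (k + 1)))
    (hfloor : ∀ k, ordZero (c k).F ≠ (5 : ℕ)) {k₀ : ℕ} (hshade : ∀ k, k₀ ≤ k → (c k).shade = ((4 : ℕ) : ℕ∞))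
    (hwt : ∀ k, k₀ ≤ k → (∀ i, (c k).r i ≤ 1) ∧ (c k).r.degree = 2) {m : ℕ} (hm : k₀ ≤ m) : ordZero (c m).F = 6 := by
  haveI : Fact (Nat.Prime 5) := ⟨by norm_num⟩
  obtain ⟨o, ho, hpo, -, hod⟩ := chain_shade_nat 5 hc hfloor hshade hm
  rw [(hwt m hm).2] at hod
  rw [ho]
  have : o = 6 := by omega
  rw [this]; rfl

omit [CharP K 5] in
/-- **Every step direction of the light-pair tail charges a boundary letter** (a slot step has coordinate `1` at its slot chart; a
rotation translates the slot it drops). [OURS] [cite: Hauser2010, §F (transform D')] -/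
theorem lightPair_direction_slot {c : ℕ → State K} {j : ℕ → Fin 4} {b : ℕ → Fin 4 → K}
    (hc : ∀ k, IsIsolated 5 (c k).F ∧ Step0 5 (c k) (c (k + 1))) (hw : FreeTail.IsWitnessedChain 5 c j b)
    (hfloor : ∀ k, ordZero (c k).F ≠ (5 : ℕ)) {k₀ : ℕ}
    (hshade : ∀ k, k₀ ≤ k → (c k).shade = ((4 : ℕ) : ℕ∞))
    (hwt : ∀ k, k₀ ≤ k → (∀ i, (c k).r i ≤ 1) ∧ (c k).r.degree = 2) {m : ℕ} (hm : k₀ ≤ m) :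
    ∃ z, 1 ≤ (c m).r z ∧ direction (j m) (b m) z ≠ 0 := by
  have ho : ordZero (c m).F = 6 := lightPair_ordZero_six hc hfloor hshade hwt hm
  have hstep : c (m + 1) = CentreBlowup.step 5 Finset.univ (j m) (b m) (c m) := (hw m).2.2.2.2
  obtain ⟨x, y, hxy, hrm⟩ := exists_pair_letters (hwt m hm).1 (hwt m hm).2
  obtain ⟨v, -, hv⟩ : ∃ v ∈ (Finset.univ : Finset (Fin 4)), v ∉ ({x, y} : Finset (Fin 4)) :=
    Finset.exists_mem_notMem_of_card_lt_card (by
      rw [Finset.card_univ, Fintype.card_fin]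
      exact lt_of_le_of_lt ((Finset.card_insert_le _ _).trans (le_of_eq (by rw [Finset.card_singleton]))) (by norm_num))
  rw [Finset.mem_insert, Finset.mem_singleton, not_or] at hv
  obtain ⟨hvx, hvy⟩ := hv
  obtain ⟨w', hw'x, hw'y, hw'v, -⟩ := exists_fourth_letter hxy (Ne.symm hvx) (Ne.symm hvy)
  have hw1 : ∀ i, (CentreBlowup.step 5 Finset.univ (j m) (b m) (c m)).r i ≤ 1 := by
    rw [← hstep]; exact (hwt (m + 1) (by omega)).1
  have hdeg : (CentreBlowup.step 5 Finset.univ (j m) (b m) (c m)).r.degree = 2 := by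
    rw [← hstep]; exact (hwt (m + 1) (by omega)).2
  have hrx' : (c m).r x = 1 := by
    simp only [hrm, Finsupp.add_apply, Finsupp.single_eq_same, Finsupp.single_eq_of_ne hxy, add_zero]
  have hry' : (c m).r y = 1 := by
    simp only [hrm, Finsupp.add_apply, Finsupp.single_eq_of_ne (Ne.symm hxy), Finsupp.single_eq_same, zero_add]
  have hrx : 1 ≤ (c m).r x := le_of_eq hrx'.symm
  have hry : 1 ≤ (c m).r y := le_of_eq hry'.symm
  rcases SwapTransport.step_cases_of_weights hxy (Ne.symm hvx) (Ne.symm hw'x) (Ne.symm hvy) (Ne.symm hw'y) (Ne.symm hw'v)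
      hrm ho hw1 hdeg with ⟨hj, -, -⟩ | ⟨hj, -, -⟩ | ⟨hjvw, ⟨hbx, -, -⟩ | ⟨hby, -, -⟩⟩
  · exact ⟨x, hrx, by rw [hj, direction_apply_self]; exact one_ne_zero⟩
  · exact ⟨y, hry, by rw [hj, direction_apply_self]; exact one_ne_zero⟩
  · have hjx : x ≠ j m := by rcases hjvw with h | h <;> rw [h]; exacts [Ne.symm hvx, Ne.symm hw'x]
    exact ⟨x, hrx, by rw [direction_apply_of_ne hjx]; exact hbx⟩
  · have hjy : y ≠ j m := by rcases hjvw with h | h <;> rw [h]; exacts [Ne.symm hvy, Ne.symm hw'y]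
    exact ⟨y, hry, by rw [direction_apply_of_ne hjy]; exact hby⟩

omit [CharP K 5] in
/-- **The degenerate kernel vector propagates, and pins the next direction off `H_{j m}`** (module docstring). [OURS]
[cite: CossartJannsenSaito2020, Thm. 3.10(4), Thm. 3.14] -/
theorem lightPair_deg_step {c : ℕ → State K} {j : ℕ → Fin 4} {b : ℕ → Fin 4 → K}
    (hc : ∀ k, IsIsolated 5 (c k).F ∧ Step0 5 (c k) (c (k + 1))) (hw : FreeTail.IsWitnessedChain 5 c j b)
    (hr0 : ∀ e ∈ (c 0).F.support, (c 0).r ≤ e) (hfloor : ∀ k, ordZero (c k).F ≠ (5 : ℕ)) {k₀ : ℕ}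
    (hshade : ∀ k, k₀ ≤ k → (c k).shade = ((4 : ℕ) : ℕ∞))
    (he : ∀ k, k₀ ≤ k → Module.finrank K (resVertex (c k)) = 2)
    (hwt : ∀ k, k₀ ≤ k → (∀ i, (c k).r i ≤ 1) ∧ (c k).r.degree = 2) {m : ℕ} (hm : k₀ ≤ m)
    {w : Fin 4 → K} (hwV : w ∈ resVertex (c m)) (hw0 : w ≠ 0) (hws : ∀ i, 1 ≤ (c m).r i → w i = 0) :
    (∃ w' ∈ resVertex (c (m + 1)), w' ≠ 0 ∧ ∀ i, 1 ≤ (c (m + 1)).r i → w' i = 0) ∧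
      (∀ D' ∈ resVertex (c (m + 1)), (∃ z, 1 ≤ (c (m + 1)).r z ∧ D' z ≠ 0) → D' (j m) ≠ 0) := by
  haveI : Fact (Nat.Prime 5) := ⟨by norm_num⟩
  have ho : ordZero (c m).F = 6 := lightPair_ordZero_six hc hfloor hshade hwt hm
  have hstep : c (m + 1) = CentreBlowup.step 5 Finset.univ (j m) (b m) (c m) := (hw m).2.2.2.2
  have hbj : b m (j m) = 0 := (hw m).2.1
  have hdiv : ∀ d ∈ (c m).F.support, (c m).r ≤ d := IsolatedBand.isolated_chain_forall_le hc hr0 m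
  have hshade_eq : (CentreBlowup.step 5 Finset.univ (j m) (b m) (c m)).shade = (c m).shade := by
    rw [← hstep, hshade (m + 1) (by omega), hshade m hm]
  have he_eq : Module.finrank K (resVertex (CentreBlowup.step 5 Finset.univ (j m) (b m) (c m))) =
      Module.finrank K (resVertex (c m)) := by
    rw [← hstep, he (m + 1) (by omega), he m hm]
  have hD : direction (j m) (b m) ∈ resVertex (c m) :=
    direction_mem_resVertex_of_shade_eq (q := 5) (j m) hbj ho hdiv (by norm_num) (by norm_num) hshade_eq
  have hI2 : resVertex (c (m + 1)) ⊓ hyperplane (j m) = resVertex (c m) ⊓ hyperplane (j m) := by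
    rw [hstep]
    exact resVertex_step_inf_hyperplane_eq_of_finrank_eq (q := 5) (j m) hbj ho hdiv (by norm_num) (by norm_num) hshade_eq he_eq
  have hfin1 : Module.finrank K ↥(resVertex (c (m + 1)) ⊓ hyperplane (j m)) = 1 := by
    have h := finrank_resVertex_step_inf_hyperplane_add_one_of_finrank_eq (q := 5) (j m) hbj ho hdiv (by norm_num)
      (by norm_num) hshade_eq he_eq
    rw [← hstep, he (m + 1) (by omega)] at h
    omega
  obtain ⟨z, hrz, hDz⟩ := lightPair_direction_slot hc hw hfloor hshade hwt hm
  -- the propagated vector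
  obtain ⟨v₀, hv₀⟩ : ∃ v₀ : Fin 4 → K, v₀ = w - w (j m) • direction (j m) (b m) := ⟨_, rfl⟩
  have hv₀i : ∀ i, v₀ i = w i - w (j m) * direction (j m) (b m) i := fun i => by
    rw [hv₀, Pi.sub_apply, Pi.smul_apply, smul_eq_mul]
  have hv₀V : v₀ ∈ resVertex (c m) := by rw [hv₀]; exact Submodule.sub_mem _ hwV (Submodule.smul_mem _ _ hD)
  have hv₀j : v₀ (j m) = 0 := by rw [hv₀i, direction_apply_self, mul_one, sub_self]
  have hv₀mem : v₀ ∈ resVertex (c (m + 1)) ⊓ hyperplane (j m) := by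
    rw [hI2]; exact Submodule.mem_inf.mpr ⟨hv₀V, mem_hyperplane.mpr hv₀j⟩
  have hv₀0 : v₀ ≠ 0 := by
    intro h0
    have hwj : w (j m) = 0 := by
      have h := hv₀i z
      rw [h0, Pi.zero_apply, hws z hrz, zero_sub, eq_comm, neg_eq_zero] at h
      rcases mul_eq_zero.mp h with h | h
      · exact h
      · exact absurd h hDz
    apply hw0
    funext i
    have h := hv₀i i
    rw [h0, Pi.zero_apply, hwj, zero_mul, sub_zero] at h
    rw [Pi.zero_apply]; exact h.symm
  have hv₀s : ∀ i, 1 ≤ (c (m + 1)).r i → v₀ i = 0 := by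
    intro i hi
    rw [hstep, SwapTransport.step_r_apply_six ho] at hi
    by_cases hij : i = j m
    · rw [hij]; exact hv₀j
    · rw [if_neg hij] at hi
      by_cases hbi : b m i = 0
      · rw [if_pos hbi] at hi
        rw [hv₀i, hws i hi, direction_apply_of_ne hij, hbi, mul_zero, sub_zero]
      · rw [if_neg hbi] at hi; omega
  refine ⟨⟨v₀, (Submodule.mem_inf.mp hv₀mem).1, hv₀0, hv₀s⟩, ?_⟩
  -- the line `V_{m+1} ⊓ H_{j m} = K·v₀` pins the next direction
  rintro D' hD' ⟨z', hrz', hDz'⟩ hDj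
  have hDmem : D' ∈ resVertex (c (m + 1)) ⊓ hyperplane (j m) := Submodule.mem_inf.mpr ⟨hD', mem_hyperplane.mpr hDj⟩
  have hne : (⟨v₀, hv₀mem⟩ : ↥(resVertex (c (m + 1)) ⊓ hyperplane (j m))) ≠ 0 := fun h =>
    hv₀0 (by rw [Subtype.ext_iff] at h; exact h)
  obtain ⟨s, hs⟩ := (finrank_eq_one_iff_of_nonzero' _ hne).mp hfin1 ⟨D', hDmem⟩
  have hs' : D' = s • v₀ := by
    have h := congrArg Subtype.val hs
    exact h.symm
  have h := congrFun hs' z'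
  rw [Pi.smul_apply, smul_eq_mul, hv₀s z' hrz', mul_zero] at h
  exact hDz' h

omit [CharP K 5] in
/-- **A degenerate kernel makes the next step non-satellite.** [OURS] [cite: CossartJannsenSaito2020, Thm. 3.14] -/
theorem lightPair_not_satellite_of_deg {c : ℕ → State K} {j : ℕ → Fin 4} {b : ℕ → Fin 4 → K}
    (hc : ∀ k, IsIsolated 5 (c k).F ∧ Step0 5 (c k) (c (k + 1))) (hw : FreeTail.IsWitnessedChain 5 c j b)
    (hr0 : ∀ e ∈ (c 0).F.support, (c 0).r ≤ e) (hfloor : ∀ k, ordZero (c k).F ≠ (5 : ℕ)) {k₀ : ℕ}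
    (hshade : ∀ k, k₀ ≤ k → (c k).shade = ((4 : ℕ) : ℕ∞))
    (he : ∀ k, k₀ ≤ k → Module.finrank K (resVertex (c k)) = 2)
    (hwt : ∀ k, k₀ ≤ k → (∀ i, (c k).r i ≤ 1) ∧ (c k).r.degree = 2) {m : ℕ} (hm : k₀ ≤ m)
    (hdeg : ∃ w ∈ resVertex (c m), w ≠ 0 ∧ ∀ i, 1 ≤ (c m).r i → w i = 0) : ¬ FreeTail.IsSatellite j b m := by
  haveI : Fact (Nat.Prime 5) := ⟨by norm_num⟩
  obtain ⟨w, hwV, hw0, hws⟩ := hdeg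
  obtain ⟨-, hpin⟩ := lightPair_deg_step hc hw hr0 hfloor hshade he hwt hm hwV hw0 hws
  have ho' : ordZero (c (m + 1)).F = 6 := lightPair_ordZero_six hc hfloor hshade hwt (by omega)
  have hstep' : c (m + 1 + 1) = CentreBlowup.step 5 Finset.univ (j (m + 1)) (b (m + 1)) (c (m + 1)) := (hw (m + 1)).2.2.2.2
  have hshade_eq' : (CentreBlowup.step 5 Finset.univ (j (m + 1)) (b (m + 1)) (c (m + 1))).shade = (c (m + 1)).shade := by
    rw [← hstep', hshade (m + 1 + 1) (by omega), hshade (m + 1) (by omega)]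
  have hD' : direction (j (m + 1)) (b (m + 1)) ∈ resVertex (c (m + 1)) :=
    direction_mem_resVertex_of_shade_eq (q := 5) (j (m + 1)) ((hw (m + 1)).2.1) ho'
      (IsolatedBand.isolated_chain_forall_le hc hr0 (m + 1)) (by norm_num) (by norm_num) hshade_eq'
  rintro ⟨hjne, hbz⟩
  refine hpin _ hD' (lightPair_direction_slot hc hw hfloor hshade hwt (by omega)) ?_
  rw [direction_apply_of_ne (Ne.symm hjne), hbz]

/-- **TT HOLDS AT EVERY TIME OF THE LIGHT-PAIR TAIL**: the polar kernel of `c k` (`k ≥ k₀`) has no non-zero vector vanishing on both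
boundary letters. [OURS] [cite: CossartJannsenSaito2020, Thm. 3.14] -/
theorem lightPair_TT {c : ℕ → State K} {j : ℕ → Fin 4} {b : ℕ → Fin 4 → K}
    (hc : ∀ k, IsIsolated 5 (c k).F ∧ Step0 5 (c k) (c (k + 1))) (hw : FreeTail.IsWitnessedChain 5 c j b)
    (hr0 : ∀ e ∈ (c 0).F.support, (c 0).r ≤ e) (hfloor : ∀ k, ordZero (c k).F ≠ (5 : ℕ)) {k₀ : ℕ}
    (hshade : ∀ k, k₀ ≤ k → (c k).shade = ((4 : ℕ) : ℕ∞))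
    (he : ∀ k, k₀ ≤ k → Module.finrank K (resVertex (c k)) = 2)
    (hwt : ∀ k, k₀ ≤ k → (∀ i, (c k).r i ≤ 1) ∧ (c k).r.degree = 2) :
    ∀ k, k₀ ≤ k → ∀ v ∈ resVertex (c k), (∀ i, 1 ≤ (c k).r i → v i = 0) → v = 0 := by
  haveI : Fact (Nat.Prime 5) := ⟨by norm_num⟩
  intro k hk
  by_contra hne
  push Not at hne
  obtain ⟨w, hwV, hws, hw0⟩ := hne
  have hdeg : ∀ n, ∃ w ∈ resVertex (c (k + n)), w ≠ 0 ∧ ∀ i, 1 ≤ (c (k + n)).r i → w i = 0 := by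
    intro n
    induction n with
    | zero => exact ⟨w, hwV, hw0, hws⟩
    | succ n ih =>
      obtain ⟨w', hw'V, hw'0, hw's⟩ := ih
      exact (lightPair_deg_step hc hw hr0 hfloor hshade he hwt (m := k + n) (by omega) hw'V hw'0 hw's).1
  obtain ⟨m, hmk, hsat⟩ := exists_satellite_ge 5 hc hw k
  obtain ⟨n, rfl⟩ : ∃ n, m = k + n := ⟨m - k, by omega⟩
  exact lightPair_not_satellite_of_deg hc hw hr0 hfloor hshade he hwt (by omega) (hdeg n) hsat

/-- **THE (5,4) LIGHT-PAIR `e_G = 2` TAIL IS EMPTY** — no residual hypothesis: `no_light_pair_tail_four_five_of_TT` with TT supplied by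
`lightPair_TT`. [OURS] [cite: CossartJannsenSaito2020, Thm. 3.14] -/
theorem no_light_pair_tail_four_five {c : ℕ → State K} {j : ℕ → Fin 4} {b : ℕ → Fin 4 → K}
    (hc : ∀ k, IsIsolated 5 (c k).F ∧ Step0 5 (c k) (c (k + 1))) (hw : FreeTail.IsWitnessedChain 5 c j b)
    (hr0 : ∀ e ∈ (c 0).F.support, (c 0).r ≤ e) (hfloor : ∀ k, ordZero (c k).F ≠ (5 : ℕ)) {k₀ : ℕ}
    (hshade : ∀ k, k₀ ≤ k → (c k).shade = ((4 : ℕ) : ℕ∞))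
    (he : ∀ k, k₀ ≤ k → Module.finrank K (resVertex (c k)) = 2)
    (hwt : ∀ k, k₀ ≤ k → (∀ i, (c k).r i ≤ 1) ∧ (c k).r.degree = 2) : False := by
  refine no_light_pair_tail_four_five_of_TT hc hw hr0 hfloor hshade he hwt ⟨max k₀ 1, le_max_left _ _, le_max_right _ _, ?_⟩
  exact lightPair_TT hc hw hr0 hfloor hshade he hwt (max k₀ 1) (le_max_left _ _)

end Tail

/-- **hN4-C′ IS A THEOREM**: the light-pair `(5,4)` re-presentation binder of `no_light_pair_tail_of_representation`
(`…ResConeRepresentationSockets`, res-dim4-p-12 g4), character for character (vacuously, by `no_light_pair_tail_four_five`). [OURS]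
[cite: CossartJannsenSaito2020, Thm. 3.14] -/
theorem lightPair_representation : ∀ (c : ℕ → State K) (j : ℕ → Fin 4) (b : ℕ → Fin 4 → K),
    (∀ k, IsIsolated 5 (c k).F ∧ Step0 5 (c k) (c (k + 1))) → FreeTail.IsWitnessedChain 5 c j b →
    (∀ e ∈ (c 0).F.support, (c 0).r ≤ e) → (∀ k, ordZero (c k).F ≠ (5 : ℕ)) →
    ∀ k₀ : ℕ, (∀ k, k₀ ≤ k → (c k).shade = ((4 : ℕ) : ℕ∞)) →
    (∀ k, k₀ ≤ k → Module.finrank K (resVertex (c k)) = 2) →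
    (∀ k, k₀ ≤ k → (∀ i, (c k).r i ≤ 1) ∧ (c k).r.degree = 2) →
    ∃ (c' : ℕ → State K) (j' : ℕ → Fin 4) (b' : ℕ → Fin 4 → K) (k₀' : ℕ),
      (∀ k, IsIsolated 5 (c' k).F ∧ Step0 5 (c' k) (c' (k + 1))) ∧ FreeTail.IsWitnessedChain 5 c' j' b' ∧
      (∀ e ∈ (c' 0).F.support, (c' 0).r ≤ e) ∧ (∀ k, ordZero (c' k).F ≠ (5 : ℕ)) ∧
      (∀ k, k₀' ≤ k → (c' k).shade = ((4 : ℕ) : ℕ∞)) ∧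
      (∀ k, k₀' ≤ k → Module.finrank K (resVertex (c' k)) = 2) ∧
      (∀ k, k₀' ≤ k → ∀ i, b' k i ≠ 0 → (c' k).r i = 0) :=
  fun _ _ _ hc hw hr0 hfloor _ hshade he hwt => (no_light_pair_tail_four_five hc hw hr0 hfloor hshade he hwt).elim

end ResCone

end Summit.ResolutionOfSingularities.ResolutionOfSingularities.Theorems.PIDim4

end
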